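import Summits.SmoothPoincare4.Statement
import Literature.Topology.FourManifolds.HomotopySpheres
import Literature.Topology.FourManifolds.SmoothOrientation

/-!
# SmoothPoincare4 / PIC — reduction to the `HomotopySphere 4` form

Problem `SmoothPoincare4`, topic `PIC` (item stmt-SmoothPoincare4-0441, the shared reduction of the
geometric routes). Given the two packaging facts — a smooth 4-manifold homotopy equivalent to `S⁴`
is compact, and is orientable (`Literature.IsOrientable (𝓡 4) M`) — the statement
"every `S : Literature.HomotopySphere 4` is diffeomorphic to the round `S⁴`" implies `SmoothPoincare4`:
package `M` with the compactness instance and a chosen orientation as a `HomotopySphere 4`.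
Bookkeeping only (Hatcher 2002, Prop. 3.29 / Thm. 2.13 for compactness; Lee 2013, Thm. 15.40 for
orientability, both entering as hypotheses).
-/

open scoped Manifold ContDiff
open ContinuousMap

namespace Literature.SPC4

/-- Settles stmt-SmoothPoincare4-0441: (homotopy `S⁴` ⇒ compact) → (homotopy `S⁴` ⇒ orientable) →
(every `HomotopySphere 4` is diffeomorphic to `S⁴`) → `SmoothPoincare4`. [folklore] -/
theorem smoothPoincare4_of_forall_homotopySphere
    (hC : ∀ (M : Type) [TopologicalSpace M] [T2Space M] [SecondCountableTopology M]
      [ChartedSpace (EuclideanSpace ℝ (Fin 4)) M] [IsManifold (𝓡 4) ∞ M],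
      M ≃ₕ Metric.sphere (0 : EuclideanSpace ℝ (Fin 5)) 1 → CompactSpace M)
    (hO : ∀ (M : Type) [TopologicalSpace M] [T2Space M] [SecondCountableTopology M]
      [ChartedSpace (EuclideanSpace ℝ (Fin 4)) M] [IsManifold (𝓡 4) ∞ M],
      M ≃ₕ Metric.sphere (0 : EuclideanSpace ℝ (Fin 5)) 1 → Literature.Topology.FourManifolds.IsOrientable (𝓡 4) M)
    (hS : ∀ S : Literature.Topology.FourManifolds.HomotopySphere 4,
      Nonempty (S.carrier ≃ₘ⟮𝓡 4, 𝓡 4⟯ Metric.sphere (0 : EuclideanSpace ℝ (Fin 5)) 1)) :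
    SmoothPoincare4 := by
  intro M _ _ _ cs im e
  haveI : CompactSpace M := hC M e
  obtain ⟨o⟩ := hO M e
  exact hS ⟨M, o, ⟨e⟩⟩

end Literature.SPC4
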